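import Literature.AnabelianGeometry.AbsoluteAnabelian.AbsTopII.InertiaDecompositionCore
import Literature.AnabelianGeometry.AbsoluteAnabelian.AbsTopII.DecompositionGroups
import Literature.AnabelianGeometry.AbsoluteAnabelian.AbsTopII.InertiaGroups
import Literature.AnabelianGeometry.AbsoluteAnabelian.FreeProcyclicStructure

/-!
# [AbsTopII] Prop 1.3 (vi), (ix): "`D_v`, `D_e` are not open in `Π_H`" PROVED from the printed inputs

S. Mochizuki, *Topics in Absolute Anabelian Geometry II* [AbsTopII] (bib `MochizukiAbsTopII2013`;
locators = PDF pages of the kurims manuscript `paper:url-585b8d0ad0d9`), §1, Proposition 1.3 (vi),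
(ix) p. 12; proofs p. 16 ((vi)) and pp. 18–19 ((ix)).

abc-iut-L4-t4 typed (vi) and (ix) as the predicates `DPSCData.Prop13vi` / `DPSCData.Prop13ix`
(`AbsTopII/DecompositionGroups.lean`, p404475; FACT-LIST F-0279 / F-0277): "the image of `D_v`
(resp. `D_e`) in `H` is open; [if `𝔾` has more than one vertex] `D_v` (resp. `D_e`) is not open in
`Π_H`".  The printed proof of the FIRST halves is "since the semi-graph `𝔾` is finite, some open
subgroup of `H` necessarily fixes `v`" (continuity of the action of `H` on the finite semi-graph —
an input about the DPSC-extension that the abstract `DPSCData` does not record); they stay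
hypotheses here, verbatim.  The SECOND halves are pure group theory, kernel-checked below:

* (vi) p. 16: "if `𝔾` admits a vertex `v' ≠ v`, then `Π_{v'} ∩ Π_v` is not open in `Π_{v'}`
  [cf. [Mzk13], Proposition 1.2, (i)]; since `D_v ∩ Π_𝔾 = Π_v` [cf. [Mzk13], Proposition 1.2, (ii)],
  this implies that `D_v` is not open in `Π_H`" — inputs: [CombGC] Prop 1.2 (i) (printed "open in"
  form, the shape of abc-iut-L3's `SemiGraphs.PSCDatum.VerticialOpenInterDeterminesVertex`) and
  (ii) (`IsCommensurablyTerminal ((X.vertSub v).subgroupOf X.PiG)`);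
* (ix) pp. 18–19: "since `D_e ∩ Π_𝔾 = N_{Π_𝔾}(Π_e) = Π_e` [cf. [Mzk13], Proposition 1.2, (ii)] is
  abelian, hence not open in the slim, nontrivial profinite group `Π_𝔾`, it follows that `D_e` is
  not open in `Π_H`" — inputs: [CombGC] Prop 1.2 (ii); `Π_𝔾` slim ([CombGC] Remark 1.1.3) and
  nontrivial; `Π_e` abelian — for a node from Prop 1.3 (ii) as typed (`Π_e ⊆ I_e = Z_{Π_I}(Π_e)`,
  abc-iut-L4-t6's `DPSCIndexData.Prop_1_3_ii`), for a cusp from Prop 1.3 (i) as typed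
  (`Π_e = I_e ≅ Ẑ^Σ`, `DPSCIndexData.Prop_1_3_i`: a Hausdorff group with a dense cyclic subgroup is
  commutative, `mul_comm_of_dense_zpowers`).

Proof-only (no definitions); companion of `AbsTopII/InertiaDecompositionCore.lean` /
`InertiaDecompositionProofs.lean` (SUBDAG `plan/L4/SUBDAG-AbsTopII-Prop13.md`).  HONEST FRAMING:
classical group theory; the geometric inputs stay hypotheses (typed ≠ proved); nothing here bears
on [IUTchIII] Cor 3.12.
-/

open scoped Pointwise

namespace Literature.AnabelianGeometry.AbsoluteAnabelian

open Literature.AlgebraicGeometry.Frobenioids (IsSlimGroup)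

universe u

/-! ## Generic group theory -/

section GroupTheory

variable {G : Type u} [Group G] [TopologicalSpace G]

/-- p. 19: an abelian subgroup is "not open in the slim, nontrivial profinite group `Π_𝔾`" — in a
slim nontrivial topological group no open subgroup is commutative.
[cite: MochizukiAbsTopII2013, Prop 1.3 (ix) proof p.19] -/
theorem not_isOpen_of_comm_of_isSlimGroup [Nontrivial G] (hslim : IsSlimGroup G) {H : Subgroup G}
    (hab : ∀ x ∈ H, ∀ y ∈ H, x * y = y * x) : ¬ IsOpen (H : Set G) := by
  intro hopen
  have hle : H ≤ Subgroup.centralizer (H : Set G) := by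
    intro x hx
    rw [Subgroup.mem_centralizer_iff]
    intro y hy
    exact hab y hy x hx
  have hbot : H = ⊥ := le_bot_iff.mp (hle.trans (hslim.centralizer_eq_bot H hopen).le)
  have h2 := hslim.centralizer_eq_bot ⊥ (by rw [← hbot]; exact hopen)
  rw [Subgroup.centralizer_eq_top_iff_subset.mpr (by simp)] at h2
  exact top_ne_bot h2

/-- If `D` is open in `G` and `D ∩ N = A`, then `A` is open in `N` (subspace topology): the step
"since `D_v ∩ Π_𝔾 = Π_v`, [`D_v` open would make `Π_v` open in `Π_𝔾`]".
[cite: MochizukiAbsTopII2013, Prop 1.3 (vi) proof p.16] -/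
theorem isOpen_subgroupOf_of_inf_eq {D N A : Subgroup G} (hDN : D ⊓ N = A) (hD : IsOpen (D : Set G)) :
    IsOpen ((A.subgroupOf N : Subgroup N) : Set N) := by
  have hset : ((A.subgroupOf N : Subgroup N) : Set N) = ((↑) : N → G) ⁻¹' (D : Set G) := by
    ext x
    rw [SetLike.mem_coe, Subgroup.mem_subgroupOf, Set.mem_preimage, SetLike.mem_coe, ← hDN,
      Subgroup.mem_inf]
    exact ⟨fun h => h.1, fun h => ⟨h, x.2⟩⟩
  rw [hset]
  exact hD.preimage continuous_subtype_val

/-- If `A` is open in `N` and `B ≤ N`, then `A ∩ B` is open in `B`: the step "`Π_v` open in `Π_𝔾`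
⇒ `Π_{v'} ∩ Π_v` open in `Π_{v'}`". [cite: MochizukiAbsTopII2013, Prop 1.3 (vi) proof p.16] -/
theorem isOpen_inf_subgroupOf_of_isOpen_subgroupOf {A B N : Subgroup G} (hBN : B ≤ N)
    (hA : IsOpen ((A.subgroupOf N : Subgroup N) : Set N)) :
    IsOpen (((A ⊓ B).subgroupOf B : Subgroup B) : Set B) := by
  have hset : (((A ⊓ B).subgroupOf B : Subgroup B) : Set B) =
      (Subgroup.inclusion hBN) ⁻¹' ((A.subgroupOf N : Subgroup N) : Set N) := by
    ext x
    rw [SetLike.mem_coe, Subgroup.mem_subgroupOf, Set.mem_preimage, SetLike.mem_coe,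
      Subgroup.mem_subgroupOf, Subgroup.mem_inf]
    exact ⟨fun h => h.1, fun h => ⟨h, x.2⟩⟩
  rw [hset]
  exact hA.preimage (continuous_inclusion hBN)

end GroupTheory

/-! ## Assembly at the DPSC data -/

namespace DPSCData

variable (X : DPSCData.{u})

/-- **[AbsTopII] Prop 1.3 (vi), second half PROVED** (proof p. 16): "if `𝔾` admits a vertex
`v' ≠ v`, then `Π_{v'} ∩ Π_v` is not open in `Π_{v'}` [[Mzk13] Prop 1.2 (i)]; since `D_v ∩ Π_𝔾 = Π_v`
[[Mzk13] Prop 1.2 (ii)], this implies that `D_v` is not open in `Π_H`" — GIVEN [CombGC] Prop 1.2 (i)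
(printed "open in" form) and (ii) for verticial subgroups. [cite: MochizukiAbsTopII2013, Prop 1.3 (vi) p.12] -/
theorem not_isOpen_Dv
    (hDetv : ∀ (v v' : X.Vert) (γ : X.PiH), γ ∈ X.PiG →
      IsOpen ((((MulAut.conj γ • X.vertSub v') ⊓ X.vertSub v).subgroupOf (X.vertSub v) :
        Subgroup ↥(X.vertSub v)) : Set ↥(X.vertSub v)) → v' = v)
    (hCTv : ∀ v : X.Vert, IsCommensurablyTerminal ((X.vertSub v).subgroupOf X.PiG))
    (v : X.Vert) (hw : ∃ w : X.Vert, w ≠ v) : ¬ IsOpen (X.Dv v : Set X.PiH) := by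
  obtain ⟨w, hwv⟩ := hw
  intro hD
  have hCT : Subgroup.Commensurable.commensurator (X.vertSub v) ⊓ X.PiG ≤ X.vertSub v :=
    (isCommensurablyTerminal_subgroupOf_iff (X.vertSub_le v)).mp (hCTv v)
  -- `Π_v = D_v ∩ Π_𝔾` is open in `Π_𝔾`, hence `Π_v ∩ Π_w` is open in `Π_w`
  have h1 : IsOpen (((X.vertSub v).subgroupOf X.PiG : Subgroup X.PiG) : Set X.PiG) :=
    isOpen_subgroupOf_of_inf_eq (normalizer_inf_eq_of_ctIn (X.vertSub_le v) hCT) hD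
  have h2 := isOpen_inf_subgroupOf_of_isOpen_subgroupOf (X.vertSub_le w) h1
  apply hwv
  symm
  refine hDetv w v 1 X.PiG.one_mem ?_
  rwa [map_one, one_smul]

/-- **[AbsTopII] Prop 1.3 (vi) as typed** (`DPSCData.Prop13vi`, F-0279) from its printed inputs: the
first half ("the image of `D_v` in `H` is open" — "since the semi-graph `𝔾` is finite, some open
subgroup of `H` necessarily fixes `v`", an input on the DPSC-extension not recorded by `DPSCData`)
as a verbatim hypothesis; the second half PROVED (`not_isOpen_Dv`).
[cite: MochizukiAbsTopII2013, Prop 1.3 (vi) p.12] -/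
theorem prop13vi_of_inputs
    (himage : haveI := X.normal_PiG
      ∀ v : X.Vert, IsOpen (((X.Dv v).map (QuotientGroup.mk' X.PiG) :
        Subgroup (X.PiH ⧸ X.PiG)) : Set (X.PiH ⧸ X.PiG)))
    (hDetv : ∀ (v v' : X.Vert) (γ : X.PiH), γ ∈ X.PiG →
      IsOpen ((((MulAut.conj γ • X.vertSub v') ⊓ X.vertSub v).subgroupOf (X.vertSub v) :
        Subgroup ↥(X.vertSub v)) : Set ↥(X.vertSub v)) → v' = v)
    (hCTv : ∀ v : X.Vert, IsCommensurablyTerminal ((X.vertSub v).subgroupOf X.PiG)) :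
    X.Prop13vi :=
  fun v => ⟨himage v, X.not_isOpen_Dv hDetv hCTv v⟩

/-- **[AbsTopII] Prop 1.3 (ix), second half PROVED for a node** (proof pp. 18–19): "since
`D_e ∩ Π_𝔾 = N_{Π_𝔾}(Π_e) = Π_e` [[Mzk13] Prop 1.2 (ii)] is abelian, hence not open in the slim,
nontrivial profinite group `Π_𝔾`, it follows that `D_e` is not open in `Π_H`" — GIVEN [CombGC]
Prop 1.2 (ii) for `Π_e`, `Π_𝔾` slim ([CombGC] Rmk 1.1.3) and nontrivial, and `Π_e ⊆ I_e = Z_{Π_I}(Π_e)`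
(Prop 1.3 (ii): `Π_e` is abelian). [cite: MochizukiAbsTopII2013, Prop 1.3 (ix) p.12] -/
theorem not_isOpen_DvNode [Nontrivial ↥X.PiG] (hslim : IsSlimGroup ↥X.PiG)
    (hCTn : ∀ e : X.Node, IsCommensurablyTerminal ((X.nodeSub e).subgroupOf X.PiG))
    (hii : ∀ e : X.Node, X.nodeSub e ≤ X.IvNode e) (e : X.Node) :
    ¬ IsOpen (X.DvNode e : Set X.PiH) := by
  intro hD
  have hCT : Subgroup.Commensurable.commensurator (X.nodeSub e) ⊓ X.PiG ≤ X.nodeSub e :=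
    (isCommensurablyTerminal_subgroupOf_iff (X.nodeSub_le e)).mp (hCTn e)
  have h1 : IsOpen (((X.nodeSub e).subgroupOf X.PiG : Subgroup X.PiG) : Set X.PiG) :=
    isOpen_subgroupOf_of_inf_eq (normalizer_inf_eq_of_ctIn (X.nodeSub_le e) hCT) hD
  refine not_isOpen_of_comm_of_isSlimGroup hslim (fun x hx y hy => ?_) h1
  rw [Subgroup.mem_subgroupOf] at hx hy
  have hxZ : (x : X.PiH) ∈ Subgroup.centralizer (X.nodeSub e : Set X.PiH) := (hii e hx).1
  rw [Subgroup.mem_centralizer_iff] at hxZ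
  exact Subtype.ext (hxZ y hy).symm

/-- **[AbsTopII] Prop 1.3 (ix), second half PROVED for a cusp** (proof pp. 18–19), GIVEN [CombGC]
Prop 1.2 (ii) for `Π_e`, `Π_𝔾` slim and nontrivial, and `Π_e` abelian.
[cite: MochizukiAbsTopII2013, Prop 1.3 (ix) p.12] -/
theorem not_isOpen_DvCusp [Nontrivial ↥X.PiG] (hslim : IsSlimGroup ↥X.PiG)
    (hCTc : ∀ e : X.Cusp, IsCommensurablyTerminal ((X.cuspSub e).subgroupOf X.PiG))
    (hab : ∀ e : X.Cusp, ∀ x ∈ X.cuspSub e, ∀ y ∈ X.cuspSub e, x * y = y * x) (e : X.Cusp) :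
    ¬ IsOpen (X.DvCusp e : Set X.PiH) := by
  intro hD
  have hCT : Subgroup.Commensurable.commensurator (X.cuspSub e) ⊓ X.PiG ≤ X.cuspSub e :=
    (isCommensurablyTerminal_subgroupOf_iff (X.cuspSub_le e)).mp (hCTc e)
  have h1 : IsOpen (((X.cuspSub e).subgroupOf X.PiG : Subgroup X.PiG) : Set X.PiG) :=
    isOpen_subgroupOf_of_inf_eq (normalizer_inf_eq_of_ctIn (X.cuspSub_le e) hCT) hD
  refine not_isOpen_of_comm_of_isSlimGroup hslim (fun x hx y hy => ?_) h1
  rw [Subgroup.mem_subgroupOf] at hx hy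
  exact Subtype.ext (hab e _ hx _ hy)

/-- **[AbsTopII] Prop 1.3 (ix) as typed** (`DPSCData.Prop13ix`, F-0277) from its printed inputs: the
first halves ("the image of `D_e` in `H` is open" — finiteness of `𝔾`, an input on the
DPSC-extension) as verbatim hypotheses; the second halves PROVED (`not_isOpen_DvNode`,
`not_isOpen_DvCusp`). [cite: MochizukiAbsTopII2013, Prop 1.3 (ix) p.12] -/
theorem prop13ix_of_inputs [Nontrivial ↥X.PiG] (hslim : IsSlimGroup ↥X.PiG)
    (himageN : haveI := X.normal_PiG
      ∀ e : X.Node, IsOpen (((X.DvNode e).map (QuotientGroup.mk' X.PiG) :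
        Subgroup (X.PiH ⧸ X.PiG)) : Set (X.PiH ⧸ X.PiG)))
    (himageC : haveI := X.normal_PiG
      ∀ e : X.Cusp, IsOpen (((X.DvCusp e).map (QuotientGroup.mk' X.PiG) :
        Subgroup (X.PiH ⧸ X.PiG)) : Set (X.PiH ⧸ X.PiG)))
    (hCTn : ∀ e : X.Node, IsCommensurablyTerminal ((X.nodeSub e).subgroupOf X.PiG))
    (hCTc : ∀ e : X.Cusp, IsCommensurablyTerminal ((X.cuspSub e).subgroupOf X.PiG))
    (hii : ∀ e : X.Node, X.nodeSub e ≤ X.IvNode e)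
    (hab : ∀ e : X.Cusp, ∀ x ∈ X.cuspSub e, ∀ y ∈ X.cuspSub e, x * y = y * x) :
    X.Prop13ix :=
  ⟨fun e => ⟨himageN e, X.not_isOpen_DvNode hslim hCTn hii e⟩,
    fun e => ⟨himageC e, X.not_isOpen_DvCusp hslim hCTc hab e⟩⟩

end DPSCData

namespace AbsTopII.DPSCIndexData

variable (X : DPSCIndexData.{u})

/-- `I_e = Π_e ≅ Ẑ^Σ` for a cusp (Prop 1.3 (i) as typed, `Prop_1_3_i`) is abelian: a Hausdorff group
with a dense cyclic subgroup is commutative. [cite: MochizukiAbsTopII2013, Prop 1.3 (i) p.11] -/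
theorem cuspSub_comm_of_prop_1_3_i (h : X.Prop_1_3_i) (e : X.Cusp) :
    ∀ x ∈ X.cuspSub e, ∀ y ∈ X.cuspSub e, x * y = y * x := by
  intro x hx y hy
  obtain ⟨g, hg⟩ := (h e).exists_dense_zpowers
  have := mul_comm_of_dense_zpowers hg ⟨x, hx⟩ ⟨y, hy⟩
  exact congrArg Subtype.val this

/-- **[AbsTopII] Prop 1.3 (ix) from Prop 1.3 (i), (ii) as typed** (`Prop_1_3_i`: `I_e ≅ Ẑ^Σ` for cusps;
`Prop_1_3_ii`: `Π_e ⊆ I_e` for nodes — these give "`Π_e` abelian"), [CombGC] Prop 1.2 (ii), `Π_𝔾`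
slim and nontrivial, and the printed first halves. Conclusion: t4's `DPSCData.Prop13ix` (F-0277).
[cite: MochizukiAbsTopII2013, Prop 1.3 (ix) p.12] -/
theorem prop13ix_of_prop_1_3_i_ii [Nontrivial ↥X.PiG] (hslim : IsSlimGroup ↥X.PiG)
    (hi : X.Prop_1_3_i) (hii : X.Prop_1_3_ii)
    (himageN : haveI := X.normal_PiG
      ∀ e : X.Node, IsOpen (((X.DvNode e).map (QuotientGroup.mk' X.PiG) :
        Subgroup (X.PiH ⧸ X.PiG)) : Set (X.PiH ⧸ X.PiG)))
    (himageC : haveI := X.normal_PiG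
      ∀ e : X.Cusp, IsOpen (((X.DvCusp e).map (QuotientGroup.mk' X.PiG) :
        Subgroup (X.PiH ⧸ X.PiG)) : Set (X.PiH ⧸ X.PiG)))
    (hCTn : ∀ e : X.Node, IsCommensurablyTerminal ((X.nodeSub e).subgroupOf X.PiG))
    (hCTc : ∀ e : X.Cusp, IsCommensurablyTerminal ((X.cuspSub e).subgroupOf X.PiG)) :
    X.Prop13ix :=
  X.toDPSCData.prop13ix_of_inputs hslim himageN himageC hCTn hCTc (fun e => (hii e).1.1)
    (X.cuspSub_comm_of_prop_1_3_i hi)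

end AbsTopII.DPSCIndexData

end Literature.AnabelianGeometry.AbsoluteAnabelian
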